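import Mathlib.Data.Real.Basic
import Mathlib.Tactic.Linarith
import Mathlib.Tactic.Positivity
import Mathlib.Tactic.Ring
import Mathlib.Tactic.LinearCombination
import Mathlib.Tactic.FieldSimp
import Summits.CriticalPhenomena.PercolationContinuityZ3.Theorems.PercNearOneGluingNoHeavyLowerTailAPLGeometricClosure
import Summits.CriticalPhenomena.PercolationContinuityZ3.Theorems.PercNearOneGluingNoHeavyLowerTailAPLConjFUnionBB
import HarnessLib

/-!
# `NoHeavyLowerTail` (stmt-CriticalPhenomena-4575) — the apex piece-union preserves Harris, Gladkov–Zimin (5.1) and APL-G: the region `K = {F_b, F_c, GZ, Harris, APL-G}` is a semigroup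

Support file (prover prim-ineq-gen-8 gen 36; `--supports stmt-CriticalPhenomena-4575`; memos
run/shared/lean/prim/prim-ineq-gen-8/FINDING-gen34-CONJF.md §0(7) and FINDING-gen36-LEMMA-U.md §2).  Pure real algebra: no
definitions, no named facts, no sorries.

SETTING as in `…APLConjFUnionAssembly.lean` / `…APLConjFUnionBB.lean`: cells `u = (u0,uab,uac,ubc,u3)`, `v` of two instances `(a; b, c)`
meeting only in `{a,b,c}`, union cells `w0 = u0v0`, `wab = u0vab+uab·v0+uab·vab`, `wac`, `wbc` likewise,
`w3 = u3S_v + S_uv3 − u3v3 + uab(vac+vbc) + uac(vab+vbc) + ubc(vab+vac)`; rows Harris `eS ≤ TD` (`e = uab+uac`, `D = u0+e`,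
`T = e+u3`), GZ (5.1) `(e+ubc)S − uab² − uac² − (u0+ubc)T ≥ 0`, `F_b`, `F_c`.
* `harris_union` — Harris is preserved: the EXACT IDENTITY `Δ(w) = Δ(u)·v0·S_v + (u0(u0+uab+uac+ubc) + ubc(uab+uac))·Δ(v)
  + (u0+ubc)(v0+vbc)(uab·vac + uac·vab)` (`Δ = TD − eS`; 19 products, all coefficients `1`).
* `gz_union` — GZ (5.1) is preserved GIVEN `F_b`, `F_c` of both pieces: an exact bidegree-(2,2) certificate with 80 products of
  `{GZ, F_b, F_c, cells}(u) × {GZ, F_b, F_c, cells}(v)` (LP + exact re-solve, this session; with `GZ` alone or `GZ ∧ Harris` no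
  bidegree-(2,2) certificate exists — memo gen 36 §2 — although numerically GZ alone appears to be preserved).
* `aplg_union` — APL-G is preserved (given Harris of the pieces): gen 29's THEOREM A (`geom_compose_sq`, normalised gadget coordinates
  `x = uab/D, y = uac/D, r = T/S`) transported to cells, degenerate pieces `D = 0` included; `aplg_sq_transport` is its bookkeeping.
* `region_union` — **SEMIGROUP THEOREM** (with `conjF_union_all` of `…APLConjFUnionBB.lean`): if `u, v ≥ 0` both satisfy `F_b`, `F_c`, GZ (5.1),
  Harris and APL-G then so does `w = u ∪ v`.  This is the whole algebraic content of the induction step of THEOREM F_T (memo gen 34 §2);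
  what F_T still needs in the kernel is only the graph ↔ cells dictionary (memo gen 36 §3).
[folklore algebra; certificate data from the lineage's own LP]
-/

namespace Summit.CriticalPhenomena.PercolationContinuityZ3.Theorems

namespace APL

set_option maxHeartbeats 4000000 in
/-- **Harris is preserved by the apex piece-union** (certificate form over atoms `hcu = Δ(u)`, `hcv = Δ(v)`). [folklore] -/
theorem harris_union_cert (u0 uab uac ubc u3 v0 vab vac vbc v3 hcu hcv : ℝ)
    (ehcu : hcu = (uab+uac+u3)*(u0+uab+uac) - (uab+uac)*(u0+uab+uac+ubc+u3))
    (ehcv : hcv = (vab+vac+v3)*(v0+vab+vac) - (vab+vac)*(v0+vab+vac+vbc+v3))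
    (hu0 : 0 ≤ u0) (huab : 0 ≤ uab) (huac : 0 ≤ uac) (hubc : 0 ≤ ubc)
    (hv0 : 0 ≤ v0) (hvab : 0 ≤ vab) (hvac : 0 ≤ vac) (hvbc : 0 ≤ vbc) (hv3 : 0 ≤ v3)
    (hhcu : 0 ≤ hcu) (hhcv : 0 ≤ hcv) :
    0 ≤ ((u0*vab+uab*v0+uab*vab)+(u0*vac+uac*v0+uac*vac)+(u3*(v0+vab+vac+vbc+v3)+(u0+uab+uac+ubc+u3)*v3-u3*v3+uab*(vac+vbc)+uac*(vab+vbc)+ubc*(vab+vac)))*(u0*v0+(u0*vab+uab*v0+uab*vab)+(u0*vac+uac*v0+uac*vac))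
      - ((u0*vab+uab*v0+uab*vab)+(u0*vac+uac*v0+uac*vac))*(u0*v0+(u0*vab+uab*v0+uab*vab)+(u0*vac+uac*v0+uac*vac)+(u0*vbc+ubc*v0+ubc*vbc)+(u3*(v0+vab+vac+vbc+v3)+(u0+uab+uac+ubc+u3)*v3-u3*v3+uab*(vac+vbc)+uac*(vab+vbc)+ubc*(vab+vac))) := by
  have hsum : 0 ≤ u0*u0*hcv + u0*uab*v0*vac + u0*uab*vac*vbc + u0*uab*hcv + u0*uac*v0*vab + u0*uac*vab*vbc
      + u0*uac*hcv + u0*ubc*hcv + uab*ubc*v0*vac + uab*ubc*vac*vbc + uab*ubc*hcv + uac*ubc*v0*vab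
      + uac*ubc*vab*vbc + uac*ubc*hcv + hcu*v0*v0 + hcu*v0*vab + hcu*v0*vac + hcu*v0*vbc
      + hcu*v0*v3 := by
    positivity
  subst ehcu ehcv
  linear_combination hsum

/-- **Harris is preserved by the apex piece-union.**  `u, v ≥ 0` with `e_uS_u ≤ T_uD_u`, `e_vS_v ≤ T_vD_v` ⟹ `e_wS_w ≤ T_wD_w`. [folklore] -/
theorem harris_union (u0 uab uac ubc u3 v0 vab vac vbc v3 : ℝ)
    (hu0 : 0 ≤ u0) (huab : 0 ≤ uab) (huac : 0 ≤ uac) (hubc : 0 ≤ ubc)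
    (hv0 : 0 ≤ v0) (hvab : 0 ≤ vab) (hvac : 0 ≤ vac) (hvbc : 0 ≤ vbc) (hv3 : 0 ≤ v3)
    (hHu : (uab+uac)*(u0+uab+uac+ubc+u3) ≤ (uab+uac+u3)*(u0+uab+uac))
    (hHv : (vab+vac)*(v0+vab+vac+vbc+v3) ≤ (vab+vac+v3)*(v0+vab+vac)) :
    ((u0*vab+uab*v0+uab*vab)+(u0*vac+uac*v0+uac*vac))*(u0*v0+(u0*vab+uab*v0+uab*vab)+(u0*vac+uac*v0+uac*vac)+(u0*vbc+ubc*v0+ubc*vbc)+(u3*(v0+vab+vac+vbc+v3)+(u0+uab+uac+ubc+u3)*v3-u3*v3+uab*(vac+vbc)+uac*(vab+vbc)+ubc*(vab+vac)))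
      ≤ ((u0*vab+uab*v0+uab*vab)+(u0*vac+uac*v0+uac*vac)+(u3*(v0+vab+vac+vbc+v3)+(u0+uab+uac+ubc+u3)*v3-u3*v3+uab*(vac+vbc)+uac*(vab+vbc)+ubc*(vab+vac)))*(u0*v0+(u0*vab+uab*v0+uab*vab)+(u0*vac+uac*v0+uac*vac)) := by
  have h := harris_union_cert u0 uab uac ubc u3 v0 vab vac vbc v3 _ _ rfl rfl hu0 huab huac hubc hv0 hvab hvac hvbc hv3
    (sub_nonneg.mpr hHu) (sub_nonneg.mpr hHv)
  exact sub_nonneg.mp h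

set_option maxHeartbeats 0 in
set_option maxRecDepth 100000 in
/-- **GZ (5.1) is preserved by the apex piece-union within `F`** (certificate form over atoms: `gzu, fbu, fcu` equal to the rows GZ, `F_b`,
`F_c` of `u`, likewise for `v`, all `≥ 0`): `0 ≤ 6·GZ(u ∪ v)` by an 80-product bidegree-(2,2) certificate. [folklore] -/
theorem gz_union_cert (u0 uab uac ubc u3 v0 vab vac vbc v3 gzu fbu fcu gzv fbv fcv : ℝ)
    (egzu : gzu = (uab+uac+ubc)*(u0+uab+uac+ubc+u3) - uab^2 - uac^2 - (u0+ubc)*(uab+uac+u3))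
    (efbu : fbu = 3*(uab+uac)*(u0+uab+uac+ubc+u3) - (u0+uab+uac)*(uab+3*uac+2*u3))
    (efcu : fcu = 3*(uab+uac)*(u0+uab+uac+ubc+u3) - (u0+uab+uac)*(3*uab+uac+2*u3))
    (egzv : gzv = (vab+vac+vbc)*(v0+vab+vac+vbc+v3) - vab^2 - vac^2 - (v0+vbc)*(vab+vac+v3))
    (efbv : fbv = 3*(vab+vac)*(v0+vab+vac+vbc+v3) - (v0+vab+vac)*(vab+3*vac+2*v3))
    (efcv : fcv = 3*(vab+vac)*(v0+vab+vac+vbc+v3) - (v0+vab+vac)*(3*vab+vac+2*v3))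
    (hu0 : 0 ≤ u0) (huab : 0 ≤ uab) (huac : 0 ≤ uac) (hubc : 0 ≤ ubc) (hu3 : 0 ≤ u3)
    (hv0 : 0 ≤ v0) (hvab : 0 ≤ vab) (hvac : 0 ≤ vac) (hvbc : 0 ≤ vbc) (hv3 : 0 ≤ v3)
    (hgzu : 0 ≤ gzu) (hfbu : 0 ≤ fbu) (hfcu : 0 ≤ fcu) (hgzv : 0 ≤ gzv) (hfbv : 0 ≤ fbv) (hfcv : 0 ≤ fcv) :
    0 ≤ (6:ℝ) * (((u0*vab+uab*v0+uab*vab)+(u0*vac+uac*v0+uac*vac)+(u0*vbc+ubc*v0+ubc*vbc))*(u0*v0+(u0*vab+uab*v0+uab*vab)+(u0*vac+uac*v0+uac*vac)+(u0*vbc+ubc*v0+ubc*vbc)+(u3*(v0+vab+vac+vbc+v3)+(u0+uab+uac+ubc+u3)*v3-u3*v3+uab*(vac+vbc)+uac*(vab+vbc)+ubc*(vab+vac))) - (u0*vab+uab*v0+uab*vab)^2 - (u0*vac+uac*v0+uac*vac)^2 - (u0*v0+(u0*vbc+ubc*v0+ubc*vbc))*((u0*vab+uab*v0+uab*vab)+(u0*vac+uac*v0+uac*vac)+(u3*(v0+vab+vac+vbc+v3)+(u0+uab+uac+ubc+u3)*v3-u3*v3+uab*(vac+vbc)+uac*(vab+vbc)+ubc*(vab+vac))))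 := by
  have hsum : 0 ≤ 6*u0*u0*gzv + 10*u0*uab*vab*vac + 6*u0*uab*vab*vbc + 10*u0*uab*vab*v3 + 2*u0*uab*vac*vac + 4*u0*uab*vac*v3
      + 2*u0*uab*fcv + 4*u0*uac*v0*v3 + 2*u0*uac*vab*vab + 14*u0*uac*vab*vac + 4*u0*uac*vab*v3 + 6*u0*uac*vac*vbc
      + 10*u0*uac*vac*v3 + 2*u0*uac*fbv + 6*u0*ubc*v0*vbc + 6*u0*ubc*vab*vab + 6*u0*ubc*vac*vac + 6*u0*ubc*vbc*vbc
      + 6*u0*ubc*gzv + 2*u0*u3*v0*v3 + 4*u0*u3*vab*vab + 12*u0*u3*vab*vac + 4*u0*u3*vab*v3 + 4*u0*u3*vac*vac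
      + 4*u0*u3*vac*v3 + u0*u3*fbv + u0*u3*fcv + 4*uab*uab*v0*vac + 6*uab*uab*v0*vbc + 2*uab*uab*v0*v3
      + 2*uab*uab*vab*vac + 6*uab*uab*vab*vbc + 6*uab*uab*vab*v3 + 12*uab*uac*v0*vab + 16*uab*uac*v0*vac + 12*uab*uac*v0*v3
      + 2*uab*uac*vab*vab + 4*uab*uac*vab*vac + 4*uab*uac*vab*v3 + 6*uab*uac*vac*vac + 4*uab*uac*vac*v3 + 2*uab*uac*fbv
      + 9*uab*ubc*v0*vab + 3*uab*ubc*v0*vac + 6*uab*ubc*vab*vab + 6*uab*ubc*vab*vbc + 6*uab*ubc*vab*v3 + 11*uab*u3*v0*vab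
      + 5*uab*u3*v0*vac + 4*uab*u3*v0*v3 + 6*uab*u3*vab*vab + 4*uab*u3*vab*vac + 6*uab*u3*vab*vbc + 6*uab*u3*vab*v3
      + 4*uac*uac*v0*vab + 6*uac*uac*v0*vbc + 6*uac*uac*v0*v3 + 6*uac*uac*vab*vac + 6*uac*uac*vac*vbc + 6*uac*uac*vac*v3
      + 3*uac*ubc*v0*vab + 9*uac*ubc*v0*vac + 6*uac*ubc*vac*vac + 6*uac*ubc*vac*vbc + 6*uac*ubc*vac*v3 + 5*uac*u3*v0*vab
      + 11*uac*u3*v0*vac + 4*uac*u3*v0*v3 + 4*uac*u3*vab*vac + 6*uac*u3*vac*vac + 6*uac*u3*vac*vbc + 6*uac*u3*vac*v3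
      + 6*ubc*ubc*v0*vbc + 6*ubc*ubc*vbc*vbc + 6*gzu*v0*v0 + 6*gzu*v0*vbc + fbu*v0*vac + 2*fbu*v0*v3
      + 2*fbu*vab*vac + fcu*v0*vab := by
    positivity
  subst egzu efbu efcu egzv efbv efcv
  linear_combination hsum

/-- **GZ (5.1) is preserved by the apex piece-union within `F`.**  `u, v ≥ 0`, both with GZ (5.1), `F_b`, `F_c` ⟹ GZ (5.1) for `w = u ∪ v`.
[folklore] -/
theorem gz_union (u0 uab uac ubc u3 v0 vab vac vbc v3 : ℝ)
    (hu0 : 0 ≤ u0) (huab : 0 ≤ uab) (huac : 0 ≤ uac) (hubc : 0 ≤ ubc) (hu3 : 0 ≤ u3)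
    (hv0 : 0 ≤ v0) (hvab : 0 ≤ vab) (hvac : 0 ≤ vac) (hvbc : 0 ≤ vbc) (hv3 : 0 ≤ v3)
    (hGZu : 0 ≤ (uab+uac+ubc)*(u0+uab+uac+ubc+u3) - uab^2 - uac^2 - (u0+ubc)*(uab+uac+u3))
    (hFBu : 0 ≤ 3*(uab+uac)*(u0+uab+uac+ubc+u3) - (u0+uab+uac)*(uab+3*uac+2*u3))
    (hFCu : 0 ≤ 3*(uab+uac)*(u0+uab+uac+ubc+u3) - (u0+uab+uac)*(3*uab+uac+2*u3))
    (hGZv : 0 ≤ (vab+vac+vbc)*(v0+vab+vac+vbc+v3) - vab^2 - vac^2 - (v0+vbc)*(vab+vac+v3))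
    (hFBv : 0 ≤ 3*(vab+vac)*(v0+vab+vac+vbc+v3) - (v0+vab+vac)*(vab+3*vac+2*v3))
    (hFCv : 0 ≤ 3*(vab+vac)*(v0+vab+vac+vbc+v3) - (v0+vab+vac)*(3*vab+vac+2*v3)) :
    0 ≤ ((u0*vab+uab*v0+uab*vab)+(u0*vac+uac*v0+uac*vac)+(u0*vbc+ubc*v0+ubc*vbc))*(u0*v0+(u0*vab+uab*v0+uab*vab)+(u0*vac+uac*v0+uac*vac)+(u0*vbc+ubc*v0+ubc*vbc)+(u3*(v0+vab+vac+vbc+v3)+(u0+uab+uac+ubc+u3)*v3-u3*v3+uab*(vac+vbc)+uac*(vab+vbc)+ubc*(vab+vac))) - (u0*vab+uab*v0+uab*vab)^2 - (u0*vac+uac*v0+uac*vac)^2 - (u0*v0+(u0*vbc+ubc*v0+ubc*vbc))*((u0*vab+uab*v0+uab*vab)+(u0*vac+uac*v0+uac*vac)+(u3*(v0+vab+vac+vbc+v3)+(u0+uab+uac+ubc+u3)*v3-u3*v3+uab*(vac+vbc)+uac*(vab+vbc)+ubc*(vab+vac))) := by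
  have h := gz_union_cert u0 uab uac ubc u3 v0 vab vac vbc v3 _ _ _ _ _ _ rfl rfl rfl rfl rfl rfl hu0 huab huac hubc hu3 hv0 hvab hvac hvbc hv3
    hGZu hFBu hFCu hGZv hFBv hFCv
  exact (mul_nonneg_iff_of_pos_left (by norm_num : (0:ℝ) < (6:ℝ))).mp h

/-- Bookkeeping for `aplg_union`: transporting `m² ≤ eb·ec` through `Mg = m·K·L`, `wab = eb·K`, `wac = ec·K`. [folklore] -/
theorem aplg_sq_transport {m eb ec K L Mg wab wac : ℝ} (key : m^2 ≤ eb*ec) (hM : Mg = m*(K*L))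
    (hb : wab = eb*K) (hc : wac = ec*K) : Mg^2 ≤ wab*wac*L^2 := by
  subst hM hb hc
  have h := mul_le_mul_of_nonneg_right key (sq_nonneg (K*L))
  calc (m*(K*L))^2 = m^2 * (K*L)^2 := by ring
    _ ≤ eb*ec*(K*L)^2 := h
    _ = eb*K*(ec*K)*L^2 := by ring

set_option maxHeartbeats 0 in
/-- **APL-G is preserved by the apex piece-union (given Harris of the pieces), in cells** — gen 29's composition lemma `geom_compose_sq` /
`geom_compose_easy` (normalised gadget coordinates `x = uab/D`, `y = uac/D`, `r = T/S`) transported back to cell vectors, including the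
degenerate pieces `D = 0`.  `u, v ≥ 0` with Harris `eS ≤ TD` and APL-G `(TD − eS)² ≤ uab·uac·S²` ⟹ APL-G for `w = u ∪ v`
(Harris of `w` is `harris_union`).
[folklore] -/
theorem aplg_union (u0 uab uac ubc u3 v0 vab vac vbc v3 : ℝ)
    (hu0 : 0 ≤ u0) (huab : 0 ≤ uab) (huac : 0 ≤ uac) (hubc : 0 ≤ ubc) (hu3 : 0 ≤ u3)
    (hv0 : 0 ≤ v0) (hvab : 0 ≤ vab) (hvac : 0 ≤ vac) (hvbc : 0 ≤ vbc) (hv3 : 0 ≤ v3)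
    (hHu : (uab+uac)*(u0+uab+uac+ubc+u3) ≤ (uab+uac+u3)*(u0+uab+uac))
    (hGu : ((uab+uac+u3)*(u0+uab+uac) - (uab+uac)*(u0+uab+uac+ubc+u3))^2 ≤ uab*uac*(u0+uab+uac+ubc+u3)^2)
    (hHv : (vab+vac)*(v0+vab+vac+vbc+v3) ≤ (vab+vac+v3)*(v0+vab+vac))
    (hGv : ((vab+vac+v3)*(v0+vab+vac) - (vab+vac)*(v0+vab+vac+vbc+v3))^2 ≤ vab*vac*(v0+vab+vac+vbc+v3)^2) :
    (((u0*vab+uab*v0+uab*vab)+(u0*vac+uac*v0+uac*vac)+(u3*(v0+vab+vac+vbc+v3)+(u0+uab+uac+ubc+u3)*v3-u3*v3+uab*(vac+vbc)+uac*(vab+vbc)+ubc*(vab+vac)))*(u0*v0+(u0*vab+uab*v0+uab*vab)+(u0*vac+uac*v0+uac*vac)) - ((u0*vab+uab*v0+uab*vab)+(u0*vac+uac*v0+uac*vac))*(u0*v0+(u0*vab+uab*v0+uab*vab)+(u0*vac+uac*v0+uac*vac)+(u0*vbc+ubc*v0+ubc*vbc)+(u3*(v0+vab+vac+vbc+v3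)+(u0+uab+uac+ubc+u3)*v3-u3*v3+uab*(vac+vbc)+uac*(vab+vbc)+ubc*(vab+vac))))^2
      ≤ (u0*vab+uab*v0+uab*vab)*(u0*vac+uac*v0+uac*vac)*(u0*v0+(u0*vab+uab*v0+uab*vab)+(u0*vac+uac*v0+uac*vac)+(u0*vbc+ubc*v0+ubc*vbc)+(u3*(v0+vab+vac+vbc+v3)+(u0+uab+uac+ubc+u3)*v3-u3*v3+uab*(vac+vbc)+uac*(vab+vbc)+ubc*(vab+vac)))^2 := by
  -- the union quantities as polynomials in the pieces' aggregates
  have eW : (u0*v0+(u0*vab+uab*v0+uab*vab)+(u0*vac+uac*v0+uac*vac)+(u0*vbc+ubc*v0+ubc*vbc)+(u3*(v0+vab+vac+vbc+v3)+(u0+uab+uac+ubc+u3)*v3-u3*v3+uab*(vac+vbc)+uac*(vab+vbc)+ubc*(vab+vac)))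
      = (u0+uab+uac+ubc+u3)*(v0+vab+vac+vbc+v3) := by ring
  have eT : ((u0*vab+uab*v0+uab*vab)+(u0*vac+uac*v0+uac*vac)+(u3*(v0+vab+vac+vbc+v3)+(u0+uab+uac+ubc+u3)*v3-u3*v3+uab*(vac+vbc)+uac*(vab+vbc)+ubc*(vab+vac)))
      = (u0+uab+uac+ubc+u3)*(v0+vab+vac+vbc+v3) - (u0+ubc)*(v0+vbc) := by ring
  have eD : (u0*v0+(u0*vab+uab*v0+uab*vab)+(u0*vac+uac*v0+uac*vac))
      = (u0+uab+uac)*(v0+vab+vac) - (uab*vac+uac*vab) := by ring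
  -- APL-G of the union
  rw [eW, eT, eD]
  rcases eq_or_lt_of_le (show 0 ≤ u0+uab+uac by positivity) with hA | hA
  · -- D_u = 0: u0 = uab = uac = 0 and both sides vanish
    have e0 : u0 = 0 := by linarith
    have e1 : uab = 0 := by linarith
    have e2 : uac = 0 := by linarith
    subst e0 e1 e2
    norm_num
  rcases eq_or_lt_of_le (show 0 ≤ v0+vab+vac by positivity) with hB | hB
  · have e0 : v0 = 0 := by linarith
    have e1 : vab = 0 := by linarith
    have e2 : vac = 0 := by linarith
    subst e0 e1 e2
    norm_num
  have hSU : 0 < u0+uab+uac+ubc+u3 := by linarith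
  have hSV : 0 < v0+vab+vac+vbc+v3 := by linarith
  -- normalised gadget coordinates x = uab/D, y = uac/D, r = T/S (D = u0+uab+uac, S the mass)
  have hAne : (u0+uab+uac) ≠ 0 := ne_of_gt hA
  have hBne : (v0+vab+vac) ≠ 0 := ne_of_gt hB
  have hSUne : (u0+uab+uac+ubc+u3) ≠ 0 := ne_of_gt hSU
  have hSVne : (v0+vab+vac+vbc+v3) ≠ 0 := ne_of_gt hSV
  have key := geom_compose_sq (uab/(u0+uab+uac)) (uac/(u0+uab+uac)) ((uab+uac+u3)/(u0+uab+uac+ubc+u3)) (vab/(v0+vab+vac)) (vac/(v0+vab+vac)) ((vab+vac+v3)/(v0+vab+vac+vbc+v3))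
    (div_nonneg huab hA.le) (div_nonneg huac hA.le)
    (by rw [← add_div, div_le_div_iff₀ hA hSU]; linarith)
    (by rw [div_le_one hSU]; linarith)
    (by
      have e1 : ((uab+uac+u3)/(u0+uab+uac+ubc+u3) - uab/(u0+uab+uac) - uac/(u0+uab+uac)) = ((uab+uac+u3)*(u0+uab+uac) - (uab+uac)*(u0+uab+uac+ubc+u3)) / ((u0+uab+uac+ubc+u3)*(u0+uab+uac)) := by
        field_simp
        ring
      have e2 : uab/(u0+uab+uac) * (uac/(u0+uab+uac)) = uab*uac*(u0+uab+uac+ubc+u3)^2 / ((u0+uab+uac+ubc+u3)*(u0+uab+uac))^2 := by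
        field_simp
      rw [e1, e2, div_pow]
      exact div_le_div_of_nonneg_right (by linarith [hGu]) (by positivity))
    (div_nonneg hvab hB.le) (div_nonneg hvac hB.le)
    (by rw [← add_div, div_le_div_iff₀ hB hSV]; linarith)
    (by rw [div_le_one hSV]; linarith)
    (by
      have e1 : ((vab+vac+v3)/(v0+vab+vac+vbc+v3) - vab/(v0+vab+vac) - vac/(v0+vab+vac)) = ((vab+vac+v3)*(v0+vab+vac) - (vab+vac)*(v0+vab+vac+vbc+v3)) / ((v0+vab+vac+vbc+v3)*(v0+vab+vac)) := by
        field_simp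
        ring
      have e2 : vab/(v0+vab+vac) * (vac/(v0+vab+vac)) = vab*vac*(v0+vab+vac+vbc+v3)^2 / ((v0+vab+vac+vbc+v3)*(v0+vab+vac))^2 := by
        field_simp
      rw [e1, e2, div_pow]
      exact div_le_div_of_nonneg_right (by linarith [hGv]) (by positivity))
  -- transport the conclusion back to cells (no large `ring`: the abstract `sq_transport` does the bookkeeping over atoms)
  have em' : (((u0+uab+uac+ubc+u3)*(v0+vab+vac+vbc+v3) - (u0+ubc)*(v0+vbc)) * ((u0+uab+uac)*(v0+vab+vac) - (uab*vac+uac*vab)) - ((u0*vab+uab*v0+uab*vab)+(u0*vac+uac*v0+uac*vac)) * ((u0+uab+uac+ubc+u3)*(v0+vab+vac+vbc+v3)))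
      = ((1 - uab/(u0+uab+uac) - uac/(u0+uab+uac)) * (1 - vab/(v0+vab+vac) - vac/(v0+vab+vac)) - (1 - (uab+uac+u3)/(u0+uab+uac+ubc+u3)) * (1 - (vab+vac+v3)/(v0+vab+vac+vbc+v3)) * (1 - (uab/(u0+uab+uac)*(vac/(v0+vab+vac)) + vab/(v0+vab+vac)*(uac/(u0+uab+uac))))) * (((u0+uab+uac)*(v0+vab+vac))*((u0+uab+uac+ubc+u3)*(v0+vab+vac+vbc+v3))) := by
    field_simp
    ring
  have eb' : (u0*vab+uab*v0+uab*vab) = (uab/(u0+uab+uac) + vab/(v0+vab+vac) - uab/(u0+uab+uac)*(vab/(v0+vab+vac)) - (uab/(u0+uab+uac)*(vac/(v0+vab+vac)) + vab/(v0+vab+vac)*(uac/(u0+uab+uac)))) * ((u0+uab+uac)*(v0+vab+vac)) := by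
    field_simp
    ring
  have ec' : (u0*vac+uac*v0+uac*vac) = (uac/(u0+uab+uac) + vac/(v0+vab+vac) - uac/(u0+uab+uac)*(vac/(v0+vab+vac)) - (uab/(u0+uab+uac)*(vac/(v0+vab+vac)) + vab/(v0+vab+vac)*(uac/(u0+uab+uac)))) * ((u0+uab+uac)*(v0+vab+vac)) := by
    field_simp
    ring
  exact aplg_sq_transport key em' eb' ec'


set_option maxHeartbeats 800000 in
/-- **SEMIGROUP THEOREM: the region `K = {F_b, F_c, GZ (5.1), Harris, APL-G}` of nonnegative cell vectors is closed under the apex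
piece-union.**  `u, v ≥ 0` both satisfying `F_b`, `F_c`, GZ (5.1), Harris `eS ≤ TD` and APL-G `(TD − eS)² ≤ uab·uac·S²` ⟹ `w = u ∪ v` satisfies
all five rows (`conjF_union_all`, `gz_union`, `harris_union`, `aplg_union`).  This is the algebraic content of the induction step of THEOREM F_T
(CONJECTURE F on every `G` with `G∖{b,c}` a forest, memo gen 34 §2). [folklore] -/
theorem region_union (u0 uab uac ubc u3 v0 vab vac vbc v3 : ℝ)
    (hu0 : 0 ≤ u0) (huab : 0 ≤ uab) (huac : 0 ≤ uac) (hubc : 0 ≤ ubc) (hu3 : 0 ≤ u3)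
    (hv0 : 0 ≤ v0) (hvab : 0 ≤ vab) (hvac : 0 ≤ vac) (hvbc : 0 ≤ vbc) (hv3 : 0 ≤ v3)
    (hFBu : 0 ≤ 3*(uab+uac)*(u0+uab+uac+ubc+u3) - (u0+uab+uac)*(uab+3*uac+2*u3))
    (hFCu : 0 ≤ 3*(uab+uac)*(u0+uab+uac+ubc+u3) - (u0+uab+uac)*(3*uab+uac+2*u3))
    (hGZu : 0 ≤ (uab+uac+ubc)*(u0+uab+uac+ubc+u3) - uab^2 - uac^2 - (u0+ubc)*(uab+uac+u3))
    (hHu : (uab+uac)*(u0+uab+uac+ubc+u3) ≤ (uab+uac+u3)*(u0+uab+uac))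
    (hGu : ((uab+uac+u3)*(u0+uab+uac) - (uab+uac)*(u0+uab+uac+ubc+u3))^2 ≤ uab*uac*(u0+uab+uac+ubc+u3)^2)
    (hFBv : 0 ≤ 3*(vab+vac)*(v0+vab+vac+vbc+v3) - (v0+vab+vac)*(vab+3*vac+2*v3))
    (hFCv : 0 ≤ 3*(vab+vac)*(v0+vab+vac+vbc+v3) - (v0+vab+vac)*(3*vab+vac+2*v3))
    (hGZv : 0 ≤ (vab+vac+vbc)*(v0+vab+vac+vbc+v3) - vab^2 - vac^2 - (v0+vbc)*(vab+vac+v3))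
    (hHv : (vab+vac)*(v0+vab+vac+vbc+v3) ≤ (vab+vac+v3)*(v0+vab+vac))
    (hGv : ((vab+vac+v3)*(v0+vab+vac) - (vab+vac)*(v0+vab+vac+vbc+v3))^2 ≤ vab*vac*(v0+vab+vac+vbc+v3)^2) :
    0 ≤ 3*((u0*vab+uab*v0+uab*vab)+(u0*vac+uac*v0+uac*vac))*(u0*v0+(u0*vab+uab*v0+uab*vab)+(u0*vac+uac*v0+uac*vac)+(u0*vbc+ubc*v0+ubc*vbc)+(u3*(v0+vab+vac+vbc+v3)+(u0+uab+uac+ubc+u3)*v3-u3*v3+uab*(vac+vbc)+uac*(vab+vbc)+ubc*(vab+vac))) - (u0*v0+(u0*vab+uab*v0+uab*vab)+(u0*vac+uac*v0+uac*vac))*((u0*vab+uab*v0+uab*vab)+3*(u0*vac+uac*v0+uac*vac)+2*(u3*(v0+vab+vac+vbc+v3)+(u0+uab+uac+ubc+u3)*v3-u3*v3+uab*(vac+vbc)+uac*(vab+vbc)+ubc*(vab+vac)))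
    ∧ 0 ≤ 3*((u0*vab+uab*v0+uab*vab)+(u0*vac+uac*v0+uac*vac))*(u0*v0+(u0*vab+uab*v0+uab*vab)+(u0*vac+uac*v0+uac*vac)+(u0*vbc+ubc*v0+ubc*vbc)+(u3*(v0+vab+vac+vbc+v3)+(u0+uab+uac+ubc+u3)*v3-u3*v3+uab*(vac+vbc)+uac*(vab+vbc)+ubc*(vab+vac))) - (u0*v0+(u0*vab+uab*v0+uab*vab)+(u0*vac+uac*v0+uac*vac))*(3*(u0*vab+uab*v0+uab*vab)+(u0*vac+uac*v0+uac*vac)+2*(u3*(v0+vab+vac+vbc+v3)+(u0+uab+uac+ubc+u3)*v3-u3*v3+uab*(vac+vbc)+uac*(vab+vbc)+ubc*(vab+vac)))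
    ∧ 0 ≤ ((u0*vab+uab*v0+uab*vab)+(u0*vac+uac*v0+uac*vac)+(u0*vbc+ubc*v0+ubc*vbc))*(u0*v0+(u0*vab+uab*v0+uab*vab)+(u0*vac+uac*v0+uac*vac)+(u0*vbc+ubc*v0+ubc*vbc)+(u3*(v0+vab+vac+vbc+v3)+(u0+uab+uac+ubc+u3)*v3-u3*v3+uab*(vac+vbc)+uac*(vab+vbc)+ubc*(vab+vac))) - (u0*vab+uab*v0+uab*vab)^2 - (u0*vac+uac*v0+uac*vac)^2 - (u0*v0+(u0*vbc+ubc*v0+ubc*vbc))*((u0*vab+uab*v0+uab*vab)+(u0*vac+uac*v0+uac*vac)+(u3*(v0+vab+vac+vbc+v3)+(u0+uab+uac+ubc+u3)*v3-u3*v3+uab*(vac+vbc)+uac*(vab+vbc)+ubc*(vab+vac)))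
    ∧ ((u0*vab+uab*v0+uab*vab)+(u0*vac+uac*v0+uac*vac))*(u0*v0+(u0*vab+uab*v0+uab*vab)+(u0*vac+uac*v0+uac*vac)+(u0*vbc+ubc*v0+ubc*vbc)+(u3*(v0+vab+vac+vbc+v3)+(u0+uab+uac+ubc+u3)*v3-u3*v3+uab*(vac+vbc)+uac*(vab+vbc)+ubc*(vab+vac)))
      ≤ ((u0*vab+uab*v0+uab*vab)+(u0*vac+uac*v0+uac*vac)+(u3*(v0+vab+vac+vbc+v3)+(u0+uab+uac+ubc+u3)*v3-u3*v3+uab*(vac+vbc)+uac*(vab+vbc)+ubc*(vab+vac)))*(u0*v0+(u0*vab+uab*v0+uab*vab)+(u0*vac+uac*v0+uac*vac))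
    ∧ (((u0*vab+uab*v0+uab*vab)+(u0*vac+uac*v0+uac*vac)+(u3*(v0+vab+vac+vbc+v3)+(u0+uab+uac+ubc+u3)*v3-u3*v3+uab*(vac+vbc)+uac*(vab+vbc)+ubc*(vab+vac)))*(u0*v0+(u0*vab+uab*v0+uab*vab)+(u0*vac+uac*v0+uac*vac)) - ((u0*vab+uab*v0+uab*vab)+(u0*vac+uac*v0+uac*vac))*(u0*v0+(u0*vab+uab*v0+uab*vab)+(u0*vac+uac*v0+uac*vac)+(u0*vbc+ubc*v0+ubc*vbc)+(u3*(v0+vab+vac+vbc+v3)+(u0+uab+uac+ubc+u3)*v3-u3*v3+uab*(vac+vbc)+uac*(vab+vbc)+ubc*(vab+vac))))^2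
      ≤ (u0*vab+uab*v0+uab*vab)*(u0*vac+uac*v0+uac*vac)*(u0*v0+(u0*vab+uab*v0+uab*vab)+(u0*vac+uac*v0+uac*vac)+(u0*vbc+ubc*v0+ubc*vbc)+(u3*(v0+vab+vac+vbc+v3)+(u0+uab+uac+ubc+u3)*v3-u3*v3+uab*(vac+vbc)+uac*(vab+vbc)+ubc*(vab+vac)))^2 := by
  obtain ⟨hb, hc⟩ := conjF_union_all u0 uab uac ubc u3 v0 vab vac vbc v3 hu0 huab huac hubc hu3 hv0 hvab hvac hvbc hv3
    hFBu hFCu hGZu hHu hGu hFBv hFCv hGZv hHv hGv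
  exact ⟨hb, hc, gz_union u0 uab uac ubc u3 v0 vab vac vbc v3 hu0 huab huac hubc hu3 hv0 hvab hvac hvbc hv3 hGZu hFBu hFCu hGZv hFBv hFCv,
    harris_union u0 uab uac ubc u3 v0 vab vac vbc v3 hu0 huab huac hubc hv0 hvab hvac hvbc hv3 hHu hHv,
    aplg_union u0 uab uac ubc u3 v0 vab vac vbc v3 hu0 huab huac hubc hu3 hv0 hvab hvac hvbc hv3 hHu hGu hHv hGv⟩

end APL

end Summit.CriticalPhenomena.PercolationContinuityZ3.Theorems
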